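import Mathlib
import HarnessLib
import Literature.Algebra.EuclideanLattices.FccBccLattices
import Summits.AtomisticToContinuum.Crystallization.Theorems.PricedLinkCensusSoftLayerPropagationStubMetricScaled
import Summits.AtomisticToContinuum.Crystallization.Theorems.PricedLinkCensusSoftLayerPropagationHXRhombus

/-!
# No common neighbour of a hexagon-opposite pair outside the star (crux `SoftLayerPropagation`, line `Sketch`)

Route `PricedLinkCensus`, crux `SoftLayerPropagation` (stmt-AtomisticToContinuum-14233), line
`Sketch`, helper file for the stub `develop_HX_fcc` (local no-merge, HEXAGON-OPPOSITE case):
registered sub-goal `hx_lens_hexagon`.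

**The lens lemma for a hexagon-opposite pair (unit scale).**  If the rhombus `x u w k` is nearly flat
(`‖(2u − x − w) + (2k − x − w)‖² < 7/10`, conclusion of `hx_rhombus`) with `‖x − w‖² ≤ 1 + 13/200`
and `‖u − x‖², ‖u − w‖², ‖k − x‖², ‖k − w‖² ≥ 1`, then no point `t` has
`‖t − u‖², ‖t − k‖² ≤ 1 + 13/200` (bonded to `u` and `k`) and `‖t − x‖², ‖t − w‖² ≥ 1` (hard core):
with `T = 2t − x − w`, the hard cores give `‖T‖² ≥ 2.93` while polarisation gives
`2⟪T, U + K⟫ = 2‖T‖² + ‖U‖² + ‖K‖² − 4‖t−u‖² − 4‖t−k‖² ≥ 2‖T‖² − 2.65`, against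
`2⟪T, U+K⟫ ≤ ‖T‖²/2 + 2‖U+K‖² < ‖T‖²/2 + 1.4`.  The distance form at scale `ℓ`
(`hx_lens_hexagon_dist`) feeds the square diagonal `p k` of the octahedron on `{x, w, p, k}` through
`hx_rhombus`.  All `[folklore]`.
-/

noncomputable section

namespace Summit.AtomisticToContinuum.Crystallization.Theorems

open Literature.Geometry.DiscreteGeometry

/-- Polarisation bookkeeping for the hexagon lens lemma. [folklore] -/
theorem lensC_identities (x w u k t : EuclideanSpace ℝ (Fin 3)) :
    ‖t - x + (t - w)‖ ^ 2 = 2 * ‖t - x‖ ^ 2 + 2 * ‖t - w‖ ^ 2 - ‖x - w‖ ^ 2 ∧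
    2 * inner ℝ (t - x + (t - w)) (u - x + (u - w) + (k - x + (k - w))) =
      2 * ‖t - x + (t - w)‖ ^ 2 + ‖u - x + (u - w)‖ ^ 2 + ‖k - x + (k - w)‖ ^ 2 -
        4 * ‖t - u‖ ^ 2 - 4 * ‖t - k‖ ^ 2 ∧
    ‖u - x + (u - w)‖ ^ 2 = 2 * ‖u - x‖ ^ 2 + 2 * ‖u - w‖ ^ 2 - ‖x - w‖ ^ 2 ∧
    ‖k - x + (k - w)‖ ^ 2 = 2 * ‖k - x‖ ^ 2 + 2 * ‖k - w‖ ^ 2 - ‖x - w‖ ^ 2 := by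
  simp only [Literature.Algebra.EuclideanLattices.inner_fin_three,
    Literature.Algebra.EuclideanLattices.norm_sq_fin_three, PiLp.add_apply, PiLp.sub_apply]
  refine ⟨by ring, by ring, by ring, by ring⟩

/-- **Registered sub-goal `hx_lens_hexagon`: the lens lemma for a hexagon-opposite pair, unit scale.**
[folklore] -/
theorem hx_lens_hexagon : ∀ (x w u k t : EuclideanSpace ℝ (Fin 3)),
    ‖x - w‖ ^ 2 ≤ 1 + 13 / 200 → 1 ≤ ‖u - x‖ ^ 2 → 1 ≤ ‖u - w‖ ^ 2 → 1 ≤ ‖k - x‖ ^ 2 → 1 ≤ ‖k - w‖ ^ 2 →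
    ‖t - u‖ ^ 2 ≤ 1 + 13 / 200 → ‖t - k‖ ^ 2 ≤ 1 + 13 / 200 → 1 ≤ ‖t - x‖ ^ 2 → 1 ≤ ‖t - w‖ ^ 2 →
    ‖u - x + (u - w) + (k - x + (k - w))‖ ^ 2 < 7 / 10 → False := by
  intro x w u k t hxw hux huw hkx hkw htu htk htx htw hflat
  obtain ⟨e1, e2, e3, e4⟩ := lensC_identities x w u k t
  have cs := real_inner_le_norm (t - x + (t - w)) (u - x + (u - w) + (k - x + (k - w)))
  generalize hT : t - x + (t - w) = T at *
  generalize hU : u - x + (u - w) = U at *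
  generalize hK : k - x + (k - w) = K at *
  have T2 : 2935 / 1000 ≤ ‖T‖ ^ 2 := by rw [e1]; linarith only [htx, htw, hxw]
  have U2 : 2935 / 1000 ≤ ‖U‖ ^ 2 := by rw [e3]; linarith only [hux, huw, hxw]
  have K2 : 2935 / 1000 ≤ ‖K‖ ^ 2 := by rw [e4]; linarith only [hkx, hkw, hxw]
  have amgm : 2 * inner ℝ T (U + K) ≤ ‖T‖ ^ 2 / 2 + 2 * ‖U + K‖ ^ 2 := by
    nlinarith only [cs, sq_nonneg (‖T‖ - 2 * ‖U + K‖), norm_nonneg T, norm_nonneg (U + K)]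
  linarith only [amgm, e2, T2, U2, K2, htu, htk, hflat]

/-- The octahedron diagonal window shrinks with the tolerance: for `α = 2ε + ε²`, `ε ≤ 1/32`, the window
`[(2 − 2α − 21α²/2)ℓ², (2 + 4α + 6α²)ℓ²]` lies inside the unit window at `α = 13/200` after rescaling.
[folklore] -/
theorem diag_window_rescale {ℓ ε : ℝ} (hℓ : 0 < ℓ) (hε : 0 ≤ ε) (hε' : ε ≤ 1 / 32)
    {p q : EuclideanSpace ℝ (Fin 3)}
    (h₁ : (2 - 2 * (2 * ε + ε ^ 2) - 21 / 2 * (2 * ε + ε ^ 2) ^ 2) * ℓ ^ 2 ≤ dist p q ^ 2)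
    (h₂ : dist p q ^ 2 ≤ (2 + 4 * (2 * ε + ε ^ 2) + 6 * (2 * ε + ε ^ 2) ^ 2) * ℓ ^ 2) :
    2 - 2 * (13 / 200) - 21 / 2 * (13 / 200) ^ 2 ≤ ‖ℓ⁻¹ • p - ℓ⁻¹ • q‖ ^ 2 ∧
      ‖ℓ⁻¹ • p - ℓ⁻¹ • q‖ ^ 2 ≤ 2 + 4 * (13 / 200) + 6 * (13 / 200) ^ 2 := by
  have hℓ2 : (0 : ℝ) < ℓ ^ 2 := by positivity
  have hα : 2 * ε + ε ^ 2 ≤ 13 / 200 := by nlinarith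
  have hα0 : 0 ≤ 2 * ε + ε ^ 2 := by positivity
  rw [norm_inv_smul_sub_sq hℓ]
  constructor
  · rw [le_div_iff₀ hℓ2]
    refine le_trans ?_ h₁
    apply mul_le_mul_of_nonneg_right _ hℓ2.le
    nlinarith
  · rw [div_le_iff₀ hℓ2]
    refine h₂.trans ?_
    apply mul_le_mul_of_nonneg_right _ hℓ2.le
    nlinarith

/-- **The lens lemma for a hexagon-opposite pair at scale `ℓ`, distance form.**  Points `x, w, u, p, k`
with the eight bonds `xw, ux, uw, px, pw, kx, kw, up` in `[ℓ, (1+ε)ℓ]` (`ε ≤ 1/32`), the square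
diagonal `pk` in the octahedron window (`α = 2ε+ε²`), `dist u k ≥ ℓ`; then no point `t` has
`dist t u, dist t k ≤ (1+ε)ℓ` and `dist t x, dist t w ≥ ℓ`. [folklore] -/
theorem hx_lens_hexagon_dist : ∀ ε ℓ : ℝ, 0 ≤ ε → ε ≤ 1 / 32 → 0 < ℓ →
    ∀ (x w u p k t : EuclideanSpace ℝ (Fin 3)),
      ℓ ≤ dist x w → dist x w ≤ (1 + ε) * ℓ → ℓ ≤ dist u x → dist u x ≤ (1 + ε) * ℓ →
      ℓ ≤ dist u w → dist u w ≤ (1 + ε) * ℓ → ℓ ≤ dist p x → dist p x ≤ (1 + ε) * ℓ →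
      ℓ ≤ dist p w → dist p w ≤ (1 + ε) * ℓ → ℓ ≤ dist k x → dist k x ≤ (1 + ε) * ℓ →
      ℓ ≤ dist k w → dist k w ≤ (1 + ε) * ℓ → ℓ ≤ dist u p → dist u p ≤ (1 + ε) * ℓ →
      (2 - 2 * (2 * ε + ε ^ 2) - 21 / 2 * (2 * ε + ε ^ 2) ^ 2) * ℓ ^ 2 ≤ dist p k ^ 2 →
      dist p k ^ 2 ≤ (2 + 4 * (2 * ε + ε ^ 2) + 6 * (2 * ε + ε ^ 2) ^ 2) * ℓ ^ 2 →
      ℓ ≤ dist u k →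
      ℓ ≤ dist t u → dist t u ≤ (1 + ε) * ℓ → ℓ ≤ dist t k → dist t k ≤ (1 + ε) * ℓ →
      ℓ ≤ dist t x → ℓ ≤ dist t w → False := by
  intro ε ℓ hε hε' hℓ x w u p k t hxw hxw' hux hux' huw huw' hpx hpx' hpw hpw' hkx hkx' hkw hkw'
    hup hup' hpk hpk' huk htu htu' htk htk' htx htw
  have W := fun {p q : EuclideanSpace ℝ (Fin 3)} (h₁ : ℓ ≤ dist p q) (h₂ : dist p q ≤ (1 + ε) * ℓ) =>
    window_rescale_13 hℓ hε hε' h₁ h₂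
  have F := fun {p q : EuclideanSpace ℝ (Fin 3)} (h₁ : ℓ ≤ dist p q) => floor_rescale hℓ h₁
  obtain ⟨dlo, dhi⟩ := diag_window_rescale hℓ hε hε' hpk hpk'
  have flat := hx_rhombus (ℓ⁻¹ • x) (ℓ⁻¹ • w) (ℓ⁻¹ • u) (ℓ⁻¹ • p) (ℓ⁻¹ • k)
    (W hxw hxw').1 (W hxw hxw').2 (W hux hux').1 (W hux hux').2 (W huw huw').1 (W huw huw').2
    (W hpx hpx').1 (W hpx hpx').2 (W hpw hpw').1 (W hpw hpw').2 (W hkx hkx').1 (W hkx hkx').2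
    (W hkw hkw').1 (W hkw hkw').2 (W hup hup').1 (W hup hup').2 dlo dhi (F huk)
  exact hx_lens_hexagon (ℓ⁻¹ • x) (ℓ⁻¹ • w) (ℓ⁻¹ • u) (ℓ⁻¹ • k) (ℓ⁻¹ • t)
    (W hxw hxw').2 (W hux hux').1 (W huw huw').1 (W hkx hkx').1 (W hkw hkw').1
    (W htu htu').2 (W htk htk').2 (F htx) (F htw) flat

end Summit.AtomisticToContinuum.Crystallization.Theorems

end
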